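import Summits.QuantumFields.YangMills.Theorems.UnitScaleTiltProp8ActionFirstVariation
import Summits.QuantumFields.YangMills.Theorems.UnitScaleTiltProp7CovariantPlaquetteExpansion
import Literature.MathematicalPhysics.QuantumFieldTheory.Balaban1983to89.T3PrintedRegularMinimiser
import HarnessLib

/-!
# Route `UnitScaleTilt`, crux K1 child «MinimiserStabilityRegPr» (stmt-QuantumFields-19200), registered stub `stub_prop7From14` (leaf V3 «Prop 7 from a
# background (14)») — **THE FIRST VARIATION OF THE WILSON ACTION IS THE PAIRING WITH THE COVARIANT DIVERGENCE OF THE CURVATURE**: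
# `Lin_{U₀}(Z) = −½·Σ_b Re Tr(Z(b)·(D^{1*}_{U₀}∂U₀)(b))`, hence `|Lin_{U₀}(Z)| ≤ ε₀·L^{−3(K−n)}·Σ_b‖Z(b)‖` on print's regular space (6)/(14)

Cell `ym3-torus` ∕ fleet seat `ym-ust-19200-p1` (gen 5).  WHERE THIS SITS.  The `ℓ²` growth assembly of this seat (`Prop7GrowthAssembly.growth_of_growthModLin`,
instance `wilsonAction4_sub_background_ge_of_modelCritical_T3`) absorbs the exact first-order term `Lin_{U₀}` of the lineage (p482559 ∕ p502026 ∕ p521440: the sum over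
plaquettes of `½Re Tr((U₀(∂p) − 1)^*·L_p(Z)·U₀(∂p))`, `L_p(Z) = δU(∂p)·U(∂p)⁻¹` the right-invariant differential of the plaquette variable) through the CURRENT
BOUND `|Lin_{U₀}(Z)| ≤ j·L^{−3(K−n)}·Σ_b‖Z(b)‖`.  The crude per-plaquette estimate (`Prop8Criticality.abs_linPlaq_le`: `|Lin_p(Z)| ≤ ‖U₀(∂p) − 1‖·Σ_{b∈∂p}‖Z(b)‖`)
only gives `j ~ ε₀L^{−2(K−n)}·L^{K−n}` — one power of `L^{K−n}` short.  The missing power is print's SECOND clause of the regular space (2)/(6)/(14), the covariant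
divergence `|(D^{η*}_U∂U)(b)| < ε₀η²(L^jη)^{−3}` ([Balaban1985RegularSpaces] (1.9); tree: `T3PrintedRegularMinimiser.DivSmall`), which enters through SUMMATION BY
PARTS: [Balaban1985BackgroundPropagators] (3.9)/(3.11) «⟨A, J⟩ = Σ_b η^d tr A(b)J(b), J = D^*η⁻²Im ∂U» — kernel-certified abstractly in the tree as
`B9Eq39Adjoint.sum_posPlaq_curl_mul`.  THIS FILE proves the exact identity for the lineage's `Lin_{U₀}` and the tree's `covDivT` and draws the bound.

WHAT IS PROVED (sorry-free, no definition; [folklore] algebra ∕ cited to the displays it instantiates).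
* §1 `trace_conjTranspose_sub_one_mul` (`Tr((P−1)^*XP) = −Tr(X(P−1))`, `PP^* = 1`), `trace_unitary_conj_mul` (`Tr(PXP^*(P−1)) = Tr(X(P−1))`, `P^*P = 1`),
  `plaqFT_unitsField_toUField` (the torus plaquette field of the `M_N(ℂ)`-reading IS the `SU(N)` plaquette variable).
* §2 **`linPlaq_eq_neg_half_re_trace_curl_mul`**: per plaquette, `½Re Tr((P₀−1)^*L_p(Z)P₀) = −½Re Tr((D_{U₀}Z)(p)·(P₀ − 1))` with [B9] (3.4)'s covariant curl
  (`B9Eq39Adjoint.curl` at the torus, = the lineage's `curl_bg_eq` form) — the two transports of `L_p` that differ from (3.4)'s (`R(Q)`, `R(P₀)` versus `R(U₀(b₄))`, `1`)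
  are absorbed by the pairing with `P₀ − 1`, which commutes with `P₀`.
* §3 `divP_plaqFT_sub_one_eq_covDivT`: [B9] (3.9)'s `D^*` of the plaquette function `∂U₀ − 1` IS the tree's covariant divergence `covDivT 1 (∂U₀)` ([B8] (1.2);
  `D^*` kills covariant constants).  **`lin_eq_neg_half_sum_re_trace_mul_covDivT`**: `Lin_{U₀}(Z) = −½Σ_b Re Tr(Z(b)·(D^{1*}_{U₀}∂U₀)_{b.dir}(b.src))` (any `SU(N)`,
  any torus of `Setup`).
* §4 **`abs_lin_le_sum_norm_mul_norm_covDivT`** (`|Lin_{U₀}(Z)| ≤ (N/2)·Σ_b‖Z(b)‖·‖(D^{1*}∂U₀)(b)‖`) and, at the d = 3 `SU(2)` carrier under print's divergence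
  clause `DivSmall F n K ε₀ U₀`, **`abs_lin_le_of_divSmall_T3`**: `|Lin_{U₀}(Z)| ≤ ε₀·(L^{K−n})⁻³·Σ_b‖Z(b)‖` — the hypothesis `hJ` of
  `Prop7GrowthAssembly.wilsonAction4_sub_background_ge_of_modelCritical_T3` with `j = ε₀`.

HONEST SCOPE.  Identities and a bound; nothing of Bałaban's is asserted.  The identity is (3.11) of [B9] read for the Wilson action's exact first variation in the
right-invariant parametrisation `U = (1+Z)U₀` of the lineage (no `exp`, no `η`-weights: lattice units, `η`-free as everywhere in the item's files).

References: T. Bałaban, CMP 99 (1985) 389–434 [Balaban1985BackgroundPropagators] ((3.4) p.391, (3.8)–(3.9), (3.11) p.392); CMP 99 (1985) 75–102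
[Balaban1985RegularSpaces] ((1.1)–(1.2) p.76, (1.9) p.77); CMP 102 (1985) 277–309 [Balaban1985Variational] ((2), (6) p.278, (14) p.280, (26)–(27) p.282).
-/

noncomputable section

open scoped BigOperators Matrix.Norms.L2Operator Matrix

namespace Summit.QuantumFields.YangMills.Theorems.Prop7FirstVariationCurrent

open Literature.MathematicalPhysics.QuantumFieldTheory.Balaban1983to89
open Finset
open B7Eq78Linearization (conjR)
open B9Eq39Adjoint (R R_def curl covD covDstar divP posPlaq sum_posPlaq sum_posPlaq_curl_mul)
open B9TorusCalculus (torusT torusT_apply torusT_symm_apply)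
open B10Eq27TorusAxialLog (holT unitsField toUField val_holT_unitsField holT_toUField holT_plaqWord_eq_plaqHol)
open B10Eq68TorusRegularity (plaqFT covDerivT covDivT)
open Summit.QuantumFields.YangMills.Theorems.Prop7CovariantCoercivity (abs_re_trace_le plaqHol_eq_word curl_bg_eq sum_plaq_eq_sum_ite)
open B10StarCount (sum_pbond)

/-! ## §1 Matrix algebra at a unitary plaquette variable, and the dictionary -/

section Algebra

variable {N : ℕ}

/-- `Tr((P − 1)^*·X·P) = −Tr(X·(P − 1))` when `PP^* = 1`. [folklore] -/
theorem trace_conjTranspose_sub_one_mul (P X : Matrix (Fin N) (Fin N) ℂ) (hP : P * star P = 1) :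
    ((P - 1)ᴴ * (X * P)).trace = -(X * (P - 1)).trace := by
  rw [Matrix.conjTranspose_sub, Matrix.conjTranspose_one, ← Matrix.star_eq_conjTranspose, Matrix.trace_mul_comm, Matrix.mul_sub, Matrix.mul_one,
    Matrix.mul_assoc, hP, Matrix.mul_one, Matrix.mul_sub, Matrix.mul_one, Matrix.trace_sub, Matrix.trace_sub]
  ring

/-- `Tr(P·X·P^*·(P − 1)) = Tr(X·(P − 1))` when `P^*P = 1` (`P^*(P − 1)P = P − 1`). [folklore] -/
theorem trace_unitary_conj_mul (P X : Matrix (Fin N) (Fin N) ℂ) (hP : star P * P = 1) :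
    (P * X * star P * (P - 1)).trace = (X * (P - 1)).trace := by
  rw [Matrix.mul_assoc, Matrix.mul_assoc, Matrix.trace_mul_comm, Matrix.mul_assoc, Matrix.mul_assoc, Matrix.sub_mul, Matrix.one_mul,
    Matrix.mul_sub, ← Matrix.mul_assoc, hP, Matrix.one_mul]

variable {P : Params} {j : ℕ} [NeZero N]

/-- **DICTIONARY**: the torus plaquette field `plaqFT` of the `M_N(ℂ)`-units reading of an `SU(N)` configuration at `(p.μ, p.ν, p.src)` is the plaquette variable
`U(∂p)` of `Setup`, read in `M_N(ℂ)`. [cite: Balaban1985Averaging, (9) p.19] -/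
theorem plaqFT_unitsField_toUField (U : GaugeField P j (Matrix.specialUnitaryGroup (Fin N) ℂ)) (p : Plaq P j) :
    plaqFT (unitsField (toUField U)) p.μ p.ν p.src = ((GaugeField.plaqHol U p : Matrix.specialUnitaryGroup (Fin N) ℂ) : Matrix (Fin N) (Fin N) ℂ) := by
  rw [plaqFT, val_holT_unitsField, holT_toUField, holT_plaqWord_eq_plaqHol]
  rfl

end Algebra

/-! ## §2 Per plaquette: the first variation pairs the covariant curl with `U₀(∂p) − 1` -/

section PerPlaquette

variable {P : Params} {j : ℕ} {N : ℕ} [NeZero N]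

/-- **PER PLAQUETTE, `½Re Tr((P₀ − 1)^*·L_p(Z)·P₀) = −½Re Tr((D_{U₀}Z)(p)·(P₀ − 1))`**: the lineage's exact first-order term of `¼‖U(∂p) − 1‖²_HS` at the
background `U₀` in the direction `Z` (`L_p(Z) = Z(b₁) + R(U₀(b₁))Z(b₂) − R(Q)Z(b₃) − R(P₀)Z(b₄)`, `Q = U₀(b₁)U₀(b₂)U₀(b₃)⁻¹ = P₀U₀(b₄)`) equals minus one half the
real trace pairing of [B9] (3.4)'s covariant curl `(D_{U₀}Z)(p) = Z(b₁) + R(U₀(b₁))Z(b₂) − R(U₀(b₄))Z(b₃) − Z(b₄)` with `P₀ − 1`.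
[cite: Balaban1985BackgroundPropagators, (3.4) p.391, (3.7) p.391] -/
theorem linPlaq_eq_neg_half_re_trace_curl_mul (U₀ : GaugeField P j (Matrix.specialUnitaryGroup (Fin N) ℂ)) (Z : PBond P j → Matrix (Fin N) (Fin N) ℂ)
    (p : Plaq P j) :
    (1 / 2) * ((((((GaugeField.plaqHol U₀ p : Matrix.specialUnitaryGroup (Fin N) ℂ) : Matrix (Fin N) (Fin N) ℂ)) - 1)ᴴ
          * ((Z ⟨p.src, p.μ⟩
              + (U₀ ⟨p.src, p.μ⟩ : Matrix (Fin N) (Fin N) ℂ) * Z ⟨p.src.shift p.μ, p.ν⟩ * star (U₀ ⟨p.src, p.μ⟩ : Matrix (Fin N) (Fin N) ℂ)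
              - ((U₀ ⟨p.src, p.μ⟩ * U₀ ⟨p.src.shift p.μ, p.ν⟩ * (U₀ ⟨p.src.shift p.ν, p.μ⟩)⁻¹ : Matrix.specialUnitaryGroup (Fin N) ℂ) : Matrix (Fin N) (Fin N) ℂ)
                  * Z ⟨p.src.shift p.ν, p.μ⟩
                  * star ((U₀ ⟨p.src, p.μ⟩ * U₀ ⟨p.src.shift p.μ, p.ν⟩ * (U₀ ⟨p.src.shift p.ν, p.μ⟩)⁻¹ : Matrix.specialUnitaryGroup (Fin N) ℂ) : Matrix (Fin N) (Fin N) ℂ)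
              - ((GaugeField.plaqHol U₀ p : Matrix.specialUnitaryGroup (Fin N) ℂ) : Matrix (Fin N) (Fin N) ℂ) * Z ⟨p.src, p.ν⟩
                  * star ((GaugeField.plaqHol U₀ p : Matrix.specialUnitaryGroup (Fin N) ℂ) : Matrix (Fin N) (Fin N) ℂ))
            * ((GaugeField.plaqHol U₀ p : Matrix.specialUnitaryGroup (Fin N) ℂ) : Matrix (Fin N) (Fin N) ℂ))).trace).re
      = -(1 / 2) * ((curl (torusT P j) (fun κ z => unitsField (toUField U₀) ⟨z, κ⟩) (fun κ z => Z ⟨z, κ⟩) p.μ p.ν p.src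
          * (plaqFT (unitsField (toUField U₀)) p.μ p.ν p.src - 1)).trace).re := by
  rw [curl_bg_eq, plaqFT_unitsField_toUField]
  set P₀ : Matrix (Fin N) (Fin N) ℂ := ((GaugeField.plaqHol U₀ p : Matrix.specialUnitaryGroup (Fin N) ℂ) : Matrix (Fin N) (Fin N) ℂ) with hP₀
  set V₁ : Matrix (Fin N) (Fin N) ℂ := (U₀ ⟨p.src, p.μ⟩ : Matrix (Fin N) (Fin N) ℂ)
  set V₄ : Matrix (Fin N) (Fin N) ℂ := (U₀ ⟨p.src, p.ν⟩ : Matrix (Fin N) (Fin N) ℂ) with hV₄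
  set Q : Matrix (Fin N) (Fin N) ℂ :=
    ((U₀ ⟨p.src, p.μ⟩ * U₀ ⟨p.src.shift p.μ, p.ν⟩ * (U₀ ⟨p.src.shift p.ν, p.μ⟩)⁻¹ : Matrix.specialUnitaryGroup (Fin N) ℂ) : Matrix (Fin N) (Fin N) ℂ) with hQ
  have hPu : P₀ ∈ Matrix.unitaryGroup (Fin N) ℂ := (GaugeField.plaqHol U₀ p).2.1
  have hPP : P₀ * star P₀ = 1 := Matrix.mem_unitaryGroup_iff.mp hPu
  have hPP' : star P₀ * P₀ = 1 := Matrix.mem_unitaryGroup_iff'.mp hPu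
  have hV₄u : star V₄ * V₄ = 1 := Matrix.mem_unitaryGroup_iff'.mp (Matrix.specialUnitaryGroup_le_unitaryGroup (U₀ ⟨p.src, p.ν⟩).2)
  -- `Q = P₀·U₀(b₄)`
  have hQP : Q = P₀ * V₄ := by
    have hw : P₀ = Q * star V₄ := by
      rw [hP₀, plaqHol_eq_word]; rfl
    rw [hw, Matrix.mul_assoc, hV₄u, Matrix.mul_one]
  -- the four bond terms
  set Z₁ := Z ⟨p.src, p.μ⟩
  set Z₂ := Z ⟨p.src.shift p.μ, p.ν⟩
  set Z₃ := Z ⟨p.src.shift p.ν, p.μ⟩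
  set Z₄ := Z ⟨p.src, p.ν⟩
  have h1 := trace_conjTranspose_sub_one_mul P₀ (Z₁ + V₁ * Z₂ * star V₁ - Q * Z₃ * star Q - P₀ * Z₄ * star P₀) hPP
  have h3 : (Q * Z₃ * star Q * (P₀ - 1)).trace = (V₄ * Z₃ * star V₄ * (P₀ - 1)).trace := by
    rw [hQP, star_mul, show P₀ * V₄ * Z₃ * (star V₄ * star P₀) = P₀ * (V₄ * Z₃ * star V₄) * star P₀ by noncomm_ring,
      trace_unitary_conj_mul P₀ _ hPP']
  have h4 : (P₀ * Z₄ * star P₀ * (P₀ - 1)).trace = (Z₄ * (P₀ - 1)).trace := trace_unitary_conj_mul P₀ Z₄ hPP'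
  rw [h1]
  have hsplit : ((Z₁ + V₁ * Z₂ * star V₁ - Q * Z₃ * star Q - P₀ * Z₄ * star P₀) * (P₀ - 1)).trace
      = ((Z₁ + V₁ * Z₂ * star V₁ - V₄ * Z₃ * star V₄ - Z₄) * (P₀ - 1)).trace := by
    simp only [Matrix.sub_mul, Matrix.add_mul, Matrix.trace_sub, Matrix.trace_add, h3, h4]
  rw [hsplit, Complex.neg_re]
  ring

end PerPlaquette

/-! ## §3 Summation by parts: `Lin_{U₀}(Z) = −½Σ_b Re Tr(Z(b)·(D^{1*}_{U₀}∂U₀)(b))` -/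

section Summed

variable {P : Params} {j : ℕ}

/-- A sum over `Finset.Iio μ` as an `if`-sum. [folklore] -/
theorem sum_Iio_eq_sum_ite {M : Type*} [AddCommMonoid M] (μ : Fin P.d) (f : Fin P.d → M) :
    ∑ ν ∈ Finset.Iio μ, f ν = ∑ ν, if ν < μ then f ν else 0 := by
  rw [← Finset.sum_filter]
  congr 1
  ext ν
  simp

/-- A sum over `Finset.Ioi μ` as an `if`-sum. [folklore] -/
theorem sum_Ioi_eq_sum_ite {M : Type*} [AddCommMonoid M] (μ : Fin P.d) (f : Fin P.d → M) :
    ∑ ν ∈ Finset.Ioi μ, f ν = ∑ ν, if μ < ν then f ν else 0 := by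
  rw [← Finset.sum_filter]
  congr 1
  ext ν
  simp

variable {𝔸 : Type*} [NormedRing 𝔸] [NormedAlgebra ℂ 𝔸]

/-- [B9] (3.8)'s `D^*_ν` at the torus IS [B8] (1.1)'s backward covariant derivative `D^{1*}_{V,ν}` (`η = 1`), and it kills covariant constants:
`D^*_ν(G − 1) = D^{1*}_{V,ν}G`. [cite: Balaban1985BackgroundPropagators, (3.8) p.392; Balaban1985RegularSpaces, (1.1) p.76] -/
theorem covDstar_sub_one_eq_covDerivT (V : GaugeField P j 𝔸ˣ) (ν : Fin P.d) (G : Site P j → 𝔸) (x : Site P j) :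
    covDstar (torusT P j) (fun κ z => V ⟨z, κ⟩) ν (fun z => G z - 1) x = covDerivT 1 V ν G x := by
  rw [covDstar, covDerivT, torusT_symm_apply, inv_one, one_smul, R_def, conjR]
  simp only [mul_sub, sub_mul, mul_one, Units.mul_inv]
  abel

/-- **[B9] (3.9)'s `D^*` OF `∂V − 1` IS THE TREE'S COVARIANT DIVERGENCE `covDivT 1 V` ([B8] (1.2))**. [cite: Balaban1985BackgroundPropagators, (3.9) p.392; Balaban1985RegularSpaces, (1.2) p.76] -/
theorem divP_plaqFT_sub_one_eq_covDivT (V : GaugeField P j 𝔸ˣ) (μ : Fin P.d) (x : Site P j) :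
    divP (torusT P j) (fun κ z => V ⟨z, κ⟩) (fun κ κ' z => plaqFT V κ κ' z - 1) μ x = covDivT 1 V μ x := by
  rw [divP, covDivT, sum_Iio_eq_sum_ite, sum_Ioi_eq_sum_ite]
  simp only [covDstar_sub_one_eq_covDerivT]

/-- The real trace as an additive map has the trace property. [folklore] -/
theorem re_trace_mul_comm {N : ℕ} (a b : Matrix (Fin N) (Fin N) ℂ) :
    (Complex.reAddGroupHom.comp (Matrix.traceAddMonoidHom (Fin N) ℂ)) (a * b) = (Complex.reAddGroupHom.comp (Matrix.traceAddMonoidHom (Fin N) ℂ)) (b * a) := by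
  show ((a * b).trace).re = ((b * a).trace).re
  rw [Matrix.trace_mul_comm]

variable {N : ℕ} [NeZero N]

/-- **THE FIRST VARIATION OF THE WILSON ACTION IS THE PAIRING WITH THE COVARIANT DIVERGENCE OF THE CURVATURE**: for every `SU(N)` background `U₀` on a torus of
`Setup` and every bond field `Z`, `Σ_p ½Re Tr((U₀(∂p) − 1)^*·L_p(Z)·U₀(∂p)) = −½·Σ_b Re Tr(Z(b)·(D^{1*}_{U₀}∂U₀)_{b.dir}(b.src))` — [B9] (3.11) «⟨A, J⟩ =
Σ_b tr A(b)J(b), J = D^*∂U» for the exact first-order term of the lineage (summation by parts (3.9), `B9Eq39Adjoint.sum_posPlaq_curl_mul`).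
[cite: Balaban1985BackgroundPropagators, (3.9), (3.11) p.392] -/
theorem lin_eq_neg_half_sum_re_trace_mul_covDivT (U₀ : GaugeField P j (Matrix.specialUnitaryGroup (Fin N) ℂ)) (Z : PBond P j → Matrix (Fin N) (Fin N) ℂ) :
    ∑ p : Plaq P j, (1 / 2) * ((((((GaugeField.plaqHol U₀ p : Matrix.specialUnitaryGroup (Fin N) ℂ) : Matrix (Fin N) (Fin N) ℂ)) - 1)ᴴ
          * ((Z ⟨p.src, p.μ⟩
              + (U₀ ⟨p.src, p.μ⟩ : Matrix (Fin N) (Fin N) ℂ) * Z ⟨p.src.shift p.μ, p.ν⟩ * star (U₀ ⟨p.src, p.μ⟩ : Matrix (Fin N) (Fin N) ℂ)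
              - ((U₀ ⟨p.src, p.μ⟩ * U₀ ⟨p.src.shift p.μ, p.ν⟩ * (U₀ ⟨p.src.shift p.ν, p.μ⟩)⁻¹ : Matrix.specialUnitaryGroup (Fin N) ℂ) : Matrix (Fin N) (Fin N) ℂ)
                  * Z ⟨p.src.shift p.ν, p.μ⟩
                  * star ((U₀ ⟨p.src, p.μ⟩ * U₀ ⟨p.src.shift p.μ, p.ν⟩ * (U₀ ⟨p.src.shift p.ν, p.μ⟩)⁻¹ : Matrix.specialUnitaryGroup (Fin N) ℂ) : Matrix (Fin N) (Fin N) ℂ)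
              - ((GaugeField.plaqHol U₀ p : Matrix.specialUnitaryGroup (Fin N) ℂ) : Matrix (Fin N) (Fin N) ℂ) * Z ⟨p.src, p.ν⟩
                  * star ((GaugeField.plaqHol U₀ p : Matrix.specialUnitaryGroup (Fin N) ℂ) : Matrix (Fin N) (Fin N) ℂ))
            * ((GaugeField.plaqHol U₀ p : Matrix.specialUnitaryGroup (Fin N) ℂ) : Matrix (Fin N) (Fin N) ℂ))).trace).re
      = -(1 / 2) * ∑ b : PBond P j, ((Z b * covDivT 1 (unitsField (toUField U₀)) b.dir b.src).trace).re := by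
  -- per plaquette
  rw [Finset.sum_congr rfl fun p _ => linPlaq_eq_neg_half_re_trace_curl_mul U₀ Z p, ← Finset.mul_sum]
  congr 1
  set τ : Matrix (Fin N) (Fin N) ℂ →+ ℝ := Complex.reAddGroupHom.comp (Matrix.traceAddMonoidHom (Fin N) ℂ) with hτ
  have hτapp : ∀ M : Matrix (Fin N) (Fin N) ℂ, τ M = (M.trace).re := fun M => rfl
  -- Σ_p ↦ Σ_{posPlaq}
  have hplaq : ∑ p : Plaq P j, ((curl (torusT P j) (fun κ z => unitsField (toUField U₀) ⟨z, κ⟩) (fun κ z => Z ⟨z, κ⟩) p.μ p.ν p.src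
        * (plaqFT (unitsField (toUField U₀)) p.μ p.ν p.src - 1)).trace).re
      = ∑ q ∈ posPlaq (Site P j) (Fin P.d), τ (curl (torusT P j) (fun κ z => unitsField (toUField U₀) ⟨z, κ⟩) (fun κ z => Z ⟨z, κ⟩) q.2.1 q.2.2 q.1
          * (fun κ κ' z => plaqFT (unitsField (toUField U₀)) κ κ' z - 1) q.2.1 q.2.2 q.1) := by
    rw [sum_posPlaq (fun x μ ν => τ (curl (torusT P j) (fun κ z => unitsField (toUField U₀) ⟨z, κ⟩) (fun κ z => Z ⟨z, κ⟩) μ ν x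
        * (fun κ κ' z => plaqFT (unitsField (toUField U₀)) κ κ' z - 1) μ ν x)),
      ← sum_plaq_eq_sum_ite (fun x μ ν => τ (curl (torusT P j) (fun κ z => unitsField (toUField U₀) ⟨z, κ⟩) (fun κ z => Z ⟨z, κ⟩) μ ν x
        * (fun κ κ' z => plaqFT (unitsField (toUField U₀)) κ κ' z - 1) μ ν x))]
    simp only [hτapp]
  -- (3.9): summation by parts
  have h39 := sum_posPlaq_curl_mul (torusT P j) (fun κ z => unitsField (toUField U₀) ⟨z, κ⟩) τ re_trace_mul_comm (fun κ z => Z ⟨z, κ⟩)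
    (fun κ κ' z => plaqFT (unitsField (toUField U₀)) κ κ' z - 1)
  -- Σ_x Σ_μ ↦ Σ_b, and `D^*(∂V − 1) = covDivT 1 V`
  calc _ = _ := hplaq
    _ = _ := h39
    _ = ∑ x : Site P j, ∑ μ : Fin P.d, ((Z ⟨x, μ⟩ * covDivT 1 (unitsField (toUField U₀)) μ x).trace).re := by
        simp only [hτapp, divP_plaqFT_sub_one_eq_covDivT]
    _ = _ := (sum_pbond (fun b : PBond P j => ((Z b * covDivT 1 (unitsField (toUField U₀)) b.dir b.src).trace).re)).symm

/-! ## §4 The current bound -/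

/-- **`|Lin_{U₀}(Z)| ≤ (N/2)·Σ_b‖Z(b)‖·‖(D^{1*}_{U₀}∂U₀)(b)‖`** (operator norms). [cite: Balaban1985BackgroundPropagators, (3.11) p.392] -/
theorem abs_lin_le_sum_norm_mul_norm_covDivT (U₀ : GaugeField P j (Matrix.specialUnitaryGroup (Fin N) ℂ)) (Z : PBond P j → Matrix (Fin N) (Fin N) ℂ) :
    |∑ p : Plaq P j, (1 / 2) * ((((((GaugeField.plaqHol U₀ p : Matrix.specialUnitaryGroup (Fin N) ℂ) : Matrix (Fin N) (Fin N) ℂ)) - 1)ᴴ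
          * ((Z ⟨p.src, p.μ⟩
              + (U₀ ⟨p.src, p.μ⟩ : Matrix (Fin N) (Fin N) ℂ) * Z ⟨p.src.shift p.μ, p.ν⟩ * star (U₀ ⟨p.src, p.μ⟩ : Matrix (Fin N) (Fin N) ℂ)
              - ((U₀ ⟨p.src, p.μ⟩ * U₀ ⟨p.src.shift p.μ, p.ν⟩ * (U₀ ⟨p.src.shift p.ν, p.μ⟩)⁻¹ : Matrix.specialUnitaryGroup (Fin N) ℂ) : Matrix (Fin N) (Fin N) ℂ)
                  * Z ⟨p.src.shift p.ν, p.μ⟩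
                  * star ((U₀ ⟨p.src, p.μ⟩ * U₀ ⟨p.src.shift p.μ, p.ν⟩ * (U₀ ⟨p.src.shift p.ν, p.μ⟩)⁻¹ : Matrix.specialUnitaryGroup (Fin N) ℂ) : Matrix (Fin N) (Fin N) ℂ)
              - ((GaugeField.plaqHol U₀ p : Matrix.specialUnitaryGroup (Fin N) ℂ) : Matrix (Fin N) (Fin N) ℂ) * Z ⟨p.src, p.ν⟩
                  * star ((GaugeField.plaqHol U₀ p : Matrix.specialUnitaryGroup (Fin N) ℂ) : Matrix (Fin N) (Fin N) ℂ))
            * ((GaugeField.plaqHol U₀ p : Matrix.specialUnitaryGroup (Fin N) ℂ) : Matrix (Fin N) (Fin N) ℂ))).trace).re|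
      ≤ (N / 2) * ∑ b : PBond P j, ‖Z b‖ * ‖covDivT 1 (unitsField (toUField U₀)) b.dir b.src‖ := by
  rw [lin_eq_neg_half_sum_re_trace_mul_covDivT, abs_mul, abs_neg, abs_of_pos (by norm_num : (0 : ℝ) < 1 / 2),
    show (N / 2 : ℝ) * ∑ b : PBond P j, ‖Z b‖ * ‖covDivT 1 (unitsField (toUField U₀)) b.dir b.src‖
      = (1 / 2) * ∑ b : PBond P j, N * (‖Z b‖ * ‖covDivT 1 (unitsField (toUField U₀)) b.dir b.src‖) by rw [← Finset.mul_sum]; ring]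
  refine mul_le_mul_of_nonneg_left ((Finset.abs_sum_le_sum_abs _ _).trans (Finset.sum_le_sum fun b _ => ?_)) (by norm_num)
  exact (abs_re_trace_le _).trans (mul_le_mul_of_nonneg_left (norm_mul_le _ _) (Nat.cast_nonneg _))

end Summed

/-! ## §5 At the d = 3 carrier under print's divergence clause -/

section Carrier

open T3ContinuumYM3Torus T3PrintedRegularMinimiser

/-- **THE CURRENT BOUND ON PRINT'S REGULAR SPACE, d = 3 `SU(2)` CARRIER**: if `U₀` satisfies the divergence clause `‖(D^{1*}_{U₀}∂U₀)(b)‖ < ε₀L^{−3(K−n)}` of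
(2)/(6)/(14) (`DivSmall F n K ε₀ U₀`), then `|Lin_{U₀}(Z)| ≤ ε₀·(L^{K−n})⁻³·Σ_b‖Z(b)‖` for every bond field `Z` — hypothesis `hJ` of
`Prop7GrowthAssembly.wilsonAction4_sub_background_ge_of_modelCritical_T3` with `j = ε₀`.
[cite: Balaban1985Variational, (6) p.278, (14) p.280; Balaban1985RegularSpaces, (1.9) p.77] -/
theorem abs_lin_le_of_divSmall_T3 (F : T3Family) (n K : ℕ) {ε₀ : ℝ} (U₀ : GaugeField (F.P K) 0 (Matrix.specialUnitaryGroup (Fin 2) ℂ))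
    (hU₀ : DivSmall F n K ε₀ U₀) (Z : PBond (F.P K) 0 → Matrix (Fin 2) (Fin 2) ℂ) :
    |∑ p : Plaq (F.P K) 0, (1 / 2) * ((((((GaugeField.plaqHol U₀ p : Matrix.specialUnitaryGroup (Fin 2) ℂ) : Matrix (Fin 2) (Fin 2) ℂ)) - 1)ᴴ
          * ((Z ⟨p.src, p.μ⟩
              + (U₀ ⟨p.src, p.μ⟩ : Matrix (Fin 2) (Fin 2) ℂ) * Z ⟨p.src.shift p.μ, p.ν⟩ * star (U₀ ⟨p.src, p.μ⟩ : Matrix (Fin 2) (Fin 2) ℂ)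
              - ((U₀ ⟨p.src, p.μ⟩ * U₀ ⟨p.src.shift p.μ, p.ν⟩ * (U₀ ⟨p.src.shift p.ν, p.μ⟩)⁻¹ : Matrix.specialUnitaryGroup (Fin 2) ℂ) : Matrix (Fin 2) (Fin 2) ℂ)
                  * Z ⟨p.src.shift p.ν, p.μ⟩
                  * star ((U₀ ⟨p.src, p.μ⟩ * U₀ ⟨p.src.shift p.μ, p.ν⟩ * (U₀ ⟨p.src.shift p.ν, p.μ⟩)⁻¹ : Matrix.specialUnitaryGroup (Fin 2) ℂ) : Matrix (Fin 2) (Fin 2) ℂ)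
              - ((GaugeField.plaqHol U₀ p : Matrix.specialUnitaryGroup (Fin 2) ℂ) : Matrix (Fin 2) (Fin 2) ℂ) * Z ⟨p.src, p.ν⟩
                  * star ((GaugeField.plaqHol U₀ p : Matrix.specialUnitaryGroup (Fin 2) ℂ) : Matrix (Fin 2) (Fin 2) ℂ))
            * ((GaugeField.plaqHol U₀ p : Matrix.specialUnitaryGroup (Fin 2) ℂ) : Matrix (Fin 2) (Fin 2) ℂ))).trace).re|
      ≤ ε₀ * (((F.L : ℝ) ^ (K - n)) ^ 3)⁻¹ * ∑ b : PBond (F.P K) 0, ‖Z b‖ := by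
  have h := abs_lin_le_sum_norm_mul_norm_covDivT U₀ Z
  have hpow : ((F.L : ℝ)⁻¹) ^ (3 * (K - n)) = (((F.L : ℝ) ^ (K - n)) ^ 3)⁻¹ := by
    rw [inv_pow, mul_comm, pow_mul]
  have hb : ∀ b : PBond (F.P K) 0, ‖Z b‖ * ‖covDivT 1 (unitsField (toUField U₀)) b.dir b.src‖ ≤ ‖Z b‖ * (ε₀ * (((F.L : ℝ) ^ (K - n)) ^ 3)⁻¹) :=
    fun b => mul_le_mul_of_nonneg_left (by rw [← hpow]; exact (hU₀ b).le) (norm_nonneg _)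
  refine h.trans ?_
  rw [Nat.cast_ofNat, show (2 / 2 : ℝ) = 1 by norm_num, one_mul,
    show ε₀ * (((F.L : ℝ) ^ (K - n)) ^ 3)⁻¹ * ∑ b : PBond (F.P K) 0, ‖Z b‖ = ∑ b : PBond (F.P K) 0, ‖Z b‖ * (ε₀ * (((F.L : ℝ) ^ (K - n)) ^ 3)⁻¹) by
      rw [Finset.mul_sum]; exact Finset.sum_congr rfl fun b _ => by ring]
  exact Finset.sum_le_sum fun b _ => hb b

end Carrier

end Summit.QuantumFields.YangMills.Theorems.Prop7FirstVariationCurrent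

end
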